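import Mathlib.NumberTheory.LSeries.DirichletContinuation
import Mathlib.NumberTheory.DirichletCharacter.Basic
import Mathlib.NumberTheory.MulChar.Basic
import Mathlib.NumberTheory.ArithmeticFunction.VonMangoldt
import Mathlib.NumberTheory.Padics.PadicVal.Basic
import Mathlib.Analysis.SpecialFunctions.Pow.Real
import Literature.NumberTheory.Sieve.HardyLittlewood
import HarnessLib

/-!
# Barrier catalogue `Parity`: the exceptional-character (Siegel-zero) obstruction to
# shift-uniform prime-pair bounds (Goldston–Suriajaya 2021; Matomäki–Merikoski 2023)

Catalogue entry (D-0021) for the summit `Parity`, sub-problem `BatemanHorn`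
(`Literature.NumberTheory.Sieve.BatemanHornConjecture`; its simplest open instance is the prime-pair system `(X, X + k)`,
`k` even, whose Bateman–Horn / Hardy–Littlewood prediction is `∑_{n ≤ x} Λ(n)Λ(n − k) ∼ 𝔖(k) x`
with `𝔖(k) = 2C₂ ∏_{p ∣ k, p > 2} (p − 1)/(p − 2)` = the tree's `Literature.goldbachSingularSeries k`).
Goldston–Suriajaya prove that an UPPER bound slightly smaller than twice this prediction,
uniformly in the even shift `2 ≤ k ≤ x`, already forces real zeros of real Dirichlet
`L`-functions away from `1` (`β₁ < 1 − C(δ)/log² q`), a zero-repulsion not known unconditionally;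
Matomäki–Merikoski compute, in the presence of a Siegel zero, the pair correlations
`∑_{n ≤ X} Λ(n)Λ(n + h)` uniformly in `h = O(X)` and find the Hardy–Littlewood main term
multiplied by an explicit correction factor — equal to `2` at `h = q` — while for each FIXED
shift the Hardy–Littlewood asymptotic holds in long ranges of `X`.

* `primePairLambdaCount x k` — `ψ₂(x, k) = ∑_{k < n ≤ x} Λ(n)Λ(n − k)` (Goldston–Suriajaya (7));
* `HLPrimePairUpperBoundConj δ` — the "Hardy–Littlewood Prime-Pair Upper Bound Conjecture" (10);
* `WeakHLGoldbachConj δ` — the "Weak Hardy–Littlewood Goldbach Conjecture" (5), on the tree's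
  `Literature.NumberTheory.Sieve.goldbachLambdaCount`;
* `SiegelZeroPrimePairBarrier` — Goldston–Suriajaya Theorem 2 (named fact; docstring = BARRIER
  block);
* `GoldstonSuriajaya2021_goldbach` — their Theorem 1 (named fact);
* `MatomakiMerikoski2023_pairCorrelation` — Matomäki–Merikoski Theorem 1.3 for positive shifts
  (named fact); `MatomakiMerikoski2023_fixedShift` / `MatomakiMerikoski2023_fixedShift_ii` —
  their Corollary 1.1 (i) / (ii) (named facts);
* `MatomakiMerikoski2023_corollary12` — their Corollary 1.2 (ONE Goldbach count of the right order
  at an even shift `h ≡ 0 (mod q)`, `h ∈ [q^{10}, q^{η^{99/100}}]` ⇒ no exceptional zero of quality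
  `η(δ)` for `χ mod q`; named fact) and the PROVED reading
  `MatomakiMerikoski2023.lFunction_ne_zero_of_weakHLGoldbachConj` (the Weak HL–Goldbach Conjecture
  `WeakHLGoldbachConj δ` feeds it at `h = 2q^{10}` for every large `q`).

## References (read at the cited pages)

* D. A. Goldston, A. I. Suriajaya, *Note on the Goldbach conjecture and Landau–Siegel zeros*,
  arXiv:2104.09407 (2021): §1 ((1)–(10), Theorems 1–2), §2–§5 (Theorem 3 and its proof), §7
  (proof of Theorem 2). [cite: GoldstonSuriajaya2021, Theorems 1, 2, 3]
* K. Matomäki, J. Merikoski, *Siegel zeros, twin primes, Goldbach's conjecture, and primes in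
  short intervals*, IMRN 2023:23, 20337–20384 (arXiv:2112.11412): §1 (Corollaries 1.1, 1.2,
  Theorems 1.3, 1.4, Remark 1.7, and the reports on Heath-Brown 1983, Tao–Teräväinen 2021 and
  Friedlander–Goldston–Iwaniec–Suriajaya 2022). [cite: MatomakiMerikoski2023, §1]
* T. Tao, J. Teräväinen, *The Hardy–Littlewood–Chowla conjecture in the presence of a Siegel
  zero*, JLMS 106 (2022), 3317–3378 (arXiv:2109.06291): §1.1 (Definition 1.4, Theorem 1.5(i) =
  the report on Heath-Brown 1983, Corollary 1.8(i)). [cite: TaoTeravainen2021, Corollary 1.8(i)]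
* D. R. Heath-Brown, *Prime twins and Siegel zeros*, PLMS (3) 47 (1983), 193–224 (bib key
  `Heathbrown1983`; not held — its result is quoted here only as reported in
  [cite: MatomakiMerikoski2023, §1] and [cite: TaoTeravainen2021, Theorem 1.5(i)]).
-/

noncomputable section

open Filter Finset Real
open scoped ArithmeticFunction.vonMangoldt

namespace Literature.Barriers.Parity

/-! ### The objects of Goldston–Suriajaya -/

/-- `ψ₂(x, k) = ∑_{n ≤ x} Λ(n)Λ(n − k) = ∑_{k < n ≤ x} Λ(n)Λ(n − k)`, the von Mangoldt-weighted
count of prime(-power) pairs with difference `k` up to `x` (Goldston–Suriajaya (7)).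
[cite: GoldstonSuriajaya2021, (7)] -/
def primePairLambdaCount (x : ℝ) (k : ℕ) : ℝ :=
  ∑ n ∈ Ioc k ⌊x⌋₊, Λ n * Λ (n - k)

/-- `ψ₂(x, k) ≥ 0`. [folklore] -/
theorem primePairLambdaCount_nonneg (x : ℝ) (k : ℕ) : 0 ≤ primePairLambdaCount x k :=
  sum_nonneg fun _ _ =>
    mul_nonneg ArithmeticFunction.vonMangoldt_nonneg ArithmeticFunction.vonMangoldt_nonneg

/-- **Hardy–Littlewood Prime-Pair Upper Bound Conjecture** (Goldston–Suriajaya (10), as printed):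
"Given a fixed constant `0 < δ < 1`, then for even `2 ≤ k ≤ x` and sufficiently large `x`, we
have `ψ₂(x, k) ≤ (2 − δ)𝔖(k)(x − k) + o(𝔖(k)x)`", with
`𝔖(k) = 2C₂ ∏_{p ∣ k, p > 2} (p − 1)/(p − 2)` for even `k ≠ 0` ((3); the tree's
`Literature.NumberTheory.Sieve.goldbachSingularSeries`). The `o(𝔖(k)x)` is uniform in `k` (it is used for all `k = qj`
at once in §7): for every `η > 0` and all large `x`, every even `2 ≤ k ≤ x` satisfies
`ψ₂(x, k) ≤ (2 − δ)𝔖(k)(x − k) + η 𝔖(k) x`. "The conjecture we need is an upper bound that is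
slightly smaller than twice the conjectured main term" (§1); the Hardy–Littlewood conjecture
itself, (8), is `ψ₂(x, k) = 𝔖(k)(x − k) + o(𝔖(k)x)` for even `2 ≤ k ≤ x`.
[cite: GoldstonSuriajaya2021, §1 (8), (10)] -/
def HLPrimePairUpperBoundConj (δ : ℝ) : Prop :=
  ∀ η : ℝ, 0 < η → ∃ x₀ : ℝ, ∀ x : ℝ, x₀ ≤ x → ∀ k : ℕ, Even k → 2 ≤ k → (k : ℝ) ≤ x →
    primePairLambdaCount x k ≤
      (2 - δ) * Literature.NumberTheory.Sieve.goldbachSingularSeries k * (x - k) + η * (Literature.NumberTheory.Sieve.goldbachSingularSeries k * x)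

/-- **Weak Hardy–Littlewood Goldbach Conjecture** (Goldston–Suriajaya (5), as printed): "Given a
fixed constant `0 < δ < 1`, then for sufficiently large even `n`, we have
`|ψ₂(n) − 𝔖(n)n| ≤ (1 − δ)𝔖(n)n`. Equivalently, (A) `δ𝔖(n)n ≤ ψ₂(n)` and (B)
`ψ₂(n) ≤ (2 − δ)𝔖(n)n`", where `ψ₂(n) = ∑_{m + m' = n} Λ(m)Λ(m')` ((1); the tree's
`Literature.NumberTheory.Sieve.goldbachLambdaCount`, whose extra terms `m = 0` or `m' = 0` vanish as `Λ(0) = 0`).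
[cite: GoldstonSuriajaya2021, §1 (1), (5)] -/
def WeakHLGoldbachConj (δ : ℝ) : Prop :=
  ∃ n₀ : ℕ, ∀ n : ℕ, n₀ ≤ n → Even n →
    δ * (Literature.NumberTheory.Sieve.goldbachSingularSeries n * n) ≤ Literature.NumberTheory.Sieve.goldbachLambdaCount n ∧
      Literature.NumberTheory.Sieve.goldbachLambdaCount n ≤ (2 - δ) * (Literature.NumberTheory.Sieve.goldbachSingularSeries n * n)

/-! ### The barrier -/

/-- **The Siegel-zero obstruction to shift-uniform prime-pair upper bounds** (Goldston–Suriajaya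
2021, Theorem 2 with Theorem 1, as printed). Theorem 1: "Assume the Weak Hardy–Littlewood
Goldbach Conjecture. Let `q` be sufficiently large, and suppose that `χ₁` is the single real
character (mod `q`), if it exists, for which `L(s, χ₁)` has a real zero `β₁` satisfying
`1 − c/log q < β₁` for a certain positive absolute constant `c`. Then we have
`β₁ < 1 − C(δ)/log² q`, where `C(δ)` is a positive effective constant that depends on `δ`."
Theorem 2: "Theorem 1 holds if we replace the Weak Hardy–Littlewood Goldbach Conjecture with the
Hardy–Littlewood Prime-Pair Upper Bound Conjecture" (`HLPrimePairUpperBoundConj δ`). The precise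
form (Theorem 3, proved in §5 and, for pairs, §7): for any fixed `c' < c₁` (`c₁` the constant in
the prime number theorem for progressions with the exceptional term,
`ψ(x; q, a) = x/φ(q) − χ₁(a)x^{β₁}/(φ(q)β₁) + O(x e^{−c₁√log x})`),
`β₁ < 1 − ½(c')² log(1/(1 − δ)) / log² q`. Rendered: there is an absolute `c > 0` such that for
every `δ ∈ (0, 1)` for which the conjecture holds there are `C > 0` and `q₀` with: for all
`q ≥ q₀`, every real (`MulChar.IsQuadratic`: values in `{0, 1, −1}`) Dirichlet character `χ`
mod `q` and every real zero `β ∈ (1 − c/log q, 1)` of `L(s, χ)` (`DirichletCharacter.LFunction`;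
the printed `β₁` is a real zero of `L(s, χ₁)`, hence `< 1`, and `β < 1` also keeps Mathlib's
unspecified value of `LFunction` at the pole `s = 1` of the principal character out of the
statement) satisfy `β < 1 − C/log² q`. (For the `c` of the source the real character with such a
zero is unique if it exists, so quantifying over all real `χ` is the printed statement;
`IsQuadratic` includes the principal character `χ₀`, which adds nothing: for `0 < σ < 1`,
`L(σ, χ₀) = ζ(σ)∏_{p ∣ q}(1 − p^{−σ}) ≠ 0` [folklore].)
[cite: GoldstonSuriajaya2021, Theorems 1, 2, 3]

BARRIER (D-0021; one line per key):
technique_class: exceptional-character-blind siegel-zero-consistent shift-uniform-bounds uniform-hardy-littlewood uniform-bateman-horn weak-goldbach goldbach-in-progressions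
blocks: the SHIFT-UNIFORM strengthening of the prime-pair case `(X, X + k)` of `Literature.NumberTheory.Sieve.BatemanHornConjecture` / `Literature.NumberTheory.Sieve.HardyLittlewoodTuples`, in two printed forms: (i) hardness — any proof of the one-sided bound `ψ₂(x, k) ≤ (2 − δ)𝔖(k)(x − k) + o(𝔖(k)x)` uniformly for even `2 ≤ k ≤ x` (`HLPrimePairUpperBoundConj δ`; "The conjecture we need is an upper bound that is slightly smaller than twice the conjectured main term") is also a proof that "Landau–Siegel zeros can only slowly approach 1", `β₁ < 1 − C(δ)/log² q` for real zeros of real characters mod `q` [cite: GoldstonSuriajaya2021, §1, Theorem 2], likewise for the weak Hardy–Littlewood–Goldbach bounds (A), (B) [cite: GoldstonSuriajaya2021, Theorem 1], and a two-sided weak Goldbach bound at one even `h ≡ 0 (mod q)`, `h ∈ [q^{10}, q^{η^{99/100}}]`, excludes an exceptional zero `β₀ ≥ 1 − 1/(η log q)` [cite: MatomakiMerikoski2023, Corollary 1.2]; (ii) falsity in the illusory world — if `L(s, χ)` has a real zero `β₀ = 1 − 1/(η log q)` then, uniformly for `0 ≠ h = O(X)`, `X = q^V`, `V ≥ 10`,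 the pair correlation `∑_{n ≤ X} Λ(n)Λ(n + h)` equals `X𝔖_h` times an explicit correction factor, equal to `2` at `h = q` ("one would expect that `∑_{n ≤ X} Λ(n)Λ(n + q) ≈ 2𝔖_q X`. The following general theorem confirms this intuition"), up to the stated error [cite: MatomakiMerikoski2023, §1, Theorem 1.3] (`MatomakiMerikoski2023_pairCorrelation`) — so an argument all of whose steps remain valid in the presence of such zeros cannot yield the `h`-uniform Hardy–Littlewood/Bateman–Horn asymptotic.
because: averaging the pair counts over the shifts `k ≡ 0 (mod q)` with the weight `r^{2n−k}`, `r = e^{−1/N}`, gives `𝒯(q) = q⁻¹ ∑_a |Ψ(re(a/q))|² = ∑_b Ψ(r; q, b)²` up to `O(q(log q log N)²)` [cite: GoldstonSuriajaya2021, §7]; the prime number theorem for progressions with the exceptional term, `Ψ(r; q, b) = N/φ(q) + χ₁(b)Γ(β₁)N^{β₁}/φ(q) + O(N e^{−c₁√log N})`, yields `𝒯(q) = N²/φ(q) + Γ(β₁)²N^{2β₁}/φ(q) + O(N² e^{−c₁√log N})` — nearly twice `N²/φ(q)` when `β₁` is close to `1`, because the primes then concentrate on the classes `b` with `χ₁(b)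 = −1` ("the residue classes `a (mod q)` with `χ(a) = −1` contain about twice as many primes as one would expect … Consequently one would expect that `∑_{n ≤ X} Λ(n)Λ(n + q) ≈ 2𝔖_q X`" [cite: MatomakiMerikoski2023, §1], made exact uniformly in `h` by `MatomakiMerikoski2023_pairCorrelation`); against the conjectured `𝒯(q) ≤ (2 − δ)(N²/φ(q))(1 + o(1)) + O(N log² N)` at `log N = (log q / c'')²` this forces `Γ(β₁)²N^{2(β₁−1)} ≤ 1 − δ + o(1)`, i.e. `β₁ < 1 − ½(c')² log(1/(1−δ))/log² q` [cite: GoldstonSuriajaya2021, §5 and §7].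
evasions_known: none published that yield the shift-uniform bound; unconditionally Siegel's (ineffective) theorem gives `η ≪_ε q^ε` for a real zero `β₀ = 1 − 1/(η log q)` [cite: MatomakiMerikoski2023, §1]; in the opposite direction, ASSUMING an exceptional zero one PROVES the Hardy–Littlewood prime-pair asymptotic for every fixed shift in long ranges — Heath-Brown 1983 (error `O_h(X / log log η)`; range `X ∈ [q^{250}, q^{500}]` as reported in [cite: MatomakiMerikoski2023, §1], `q^{250} ≤ x ≤ q^{300}` as reported in [cite: TaoTeravainen2021, Theorem 1.5(i)]), Tao–Teräväinen (`𝔼_{n ≤ x} Λ(n + h₁)Λ(n + h₂) = 𝔖 + O(1/log^{1/20} η)` uniformly for `q^{41/2+ε₀} ≤ x ≤ q^{η^{1/2}}`) [cite: TaoTeravainen2021, Corollary 1.8(i)], Matomäki–Merikoski (`X ∈ [q^{10}, q^{10 log η}]` with error `O_{h,C}(X e^{−C√log η})`, Corollary 1.1(i) = `MatomakiMerikoski2023_fixedShift`; `X = q^V`, `V ∈ [10 log η, η^{1−ε}]` with error `O_h(X V log⁶η / η)`, Corollary 1.1(ii) = `MatomakiMerikoski2023_fixedShift_ii`) [cite: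 MatomakiMerikoski2023, Corollary 1.1].
scope_caveats: only SHIFT-UNIFORM (all even `k ≤ x`, in effect `k ≡ 0 (mod q)` with `q` the exceptional modulus) upper or two-sided bounds are obstructed — for a FIXED shift (twin primes, `k = 2`) or a fixed Bateman–Horn system nothing is blocked, and an exceptional zero even implies the fixed-shift asymptotic in long ranges [cite: MatomakiMerikoski2023, Corollary 1.1]; the conclusion is a repulsion `β₁ < 1 − C(δ)/log² q` for `q` large, not the non-existence of exceptional zeros (Friedlander–Goldston–Iwaniec–Suriajaya obtain the classical zero-free region from the weak Goldbach bounds at several `h ≡ 0 (mod q)`, as reported in [cite: MatomakiMerikoski2023, §1]); the statements concern the `Λ`-weighted counts (prime powers included) with an `o(𝔖(k)x)` uniform in `k`, and the proof of Theorem 2 is given as a modification of that of Theorem 1 [cite: GoldstonSuriajaya2021, §7]; non-linear Bateman–Horn polynomials (e.g. `n² + 1`) are not addressed by the cited sources; quantitatively, both printed forms consume only LARGE shifts (barrier audit 2026-08-16): the hardness form (i) uses the conjectured bound only through `𝒯(q) = Ψ₂(r, 0) + 2∑_j Ψ₂(r, qj)` with `∑_j 𝔖(qj) e^{−qj/N}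 = N/φ(q) + O(log N log log N)`, an average whose weight is carried by shifts `qj ≍ N` [cite: GoldstonSuriajaya2021, §7], and the illusory-world form (ii) deviates from Hardy–Littlewood only where the correction factor `corr_q(h) = 1_{φ(2^r) ∣ h} (−1)^{h/φ(2^r)} ∏_{p ∣ q', p ∤ h} (−1)/(p − 2)` is not small, while `|corr_q(h)| ≤ √(24h/q)` for a primitive quadratic character mod `q = 2^r q'` (`q'` squarefree, `r ≤ 3`; `Literature.Barriers.Parity.SiegelCorr.abs_corr_le`, proved) — so Theorem 1.3 itself yields the Hardy–Littlewood asymptotic UNIFORMLY for `1 ≤ h ≤ min(A·X, q^{1−δ})`, `X = q^V`, `V ≥ 10 log η`, with the Corollary 1.1(ii) error `O_{A,δ}((h/φ(h)) X V log⁶η/η)` (`Literature.Barriers.Parity.MatomakiMerikoski2023_smallShift_of_pairCorrelation`, proved from `MatomakiMerikoski2023_pairCorrelation` and Siegel's theorem in `SiegelZeroPrimePairsUniformShift.lean`): shift ranges below the scale of the exceptional modulus are obstructed by neither printed form [cite: MatomakiMerikoski2023, Theorem 1.3].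
status: established -/
def SiegelZeroPrimePairBarrier : Prop :=
  ∃ c : ℝ, 0 < c ∧ ∀ δ : ℝ, 0 < δ → δ < 1 → HLPrimePairUpperBoundConj δ →
    ∃ C : ℝ, 0 < C ∧ ∃ q₀ : ℕ, ∀ (q : ℕ) [NeZero q], q₀ ≤ q →
      ∀ χ : DirichletCharacter ℂ q, χ.IsQuadratic →
        ∀ β : ℝ, 1 - c / Real.log q < β → β < 1 → χ.LFunction (β : ℂ) = 0 →
          β < 1 - C / Real.log q ^ 2

/-- **Goldston–Suriajaya, Theorem 1** (as printed; see `SiegelZeroPrimePairBarrier` for the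
wording): the Weak Hardy–Littlewood Goldbach Conjecture (`WeakHLGoldbachConj δ`) implies the same
repulsion `β₁ < 1 − C(δ)/log² q` of real zeros of real characters mod `q`, `q` large; "if
`χ(−1) = −1` then this follows from (A) in (5), and if `χ(−1) = 1` then this follows from (B)".
Earlier forms: Fei 2016 (`q` prime `≡ 3 (mod 4)`), Bhowmik–Halupczok 2020 and Jia 2020
(`χ(−1) = −1`), as reported in §1. [cite: GoldstonSuriajaya2021, Theorems 1, 3] -/
def GoldstonSuriajaya2021_goldbach : Prop :=
  ∃ c : ℝ, 0 < c ∧ ∀ δ : ℝ, 0 < δ → δ < 1 → WeakHLGoldbachConj δ →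
    ∃ C : ℝ, 0 < C ∧ ∃ q₀ : ℕ, ∀ (q : ℕ) [NeZero q], q₀ ≤ q →
      ∀ χ : DirichletCharacter ℂ q, χ.IsQuadratic →
        ∀ β : ℝ, 1 - c / Real.log q < β → β < 1 → χ.LFunction (β : ℂ) = 0 →
          β < 1 - C / Real.log q ^ 2

/-! ### The illusory world: pair correlations in the presence of a Siegel zero -/

/-- **Matomäki–Merikoski 2023, Theorem 1.3** (as printed, restricted to positive shifts `h`; the
source allows `0 ≠ h = O(X)` of either sign). "Let `C ≥ 1` and `ε > 0`. Let `χ` be a primitive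
quadratic character modulo `q ≥ 2`. Write `q = 2^r q'` with `r ≥ 0` and `2 ∤ q'`. Assume that
`L(s, χ)` has a real zero `β₀` such that `β₀ = 1 − 1/(η log q)` for some `η ≥ 10`. Let
`0 ≠ h = O(X)`. We have, for any `X = q^V` with `V ≥ 10`,
`∑_{n ≤ X} Λ(n)Λ(n + h) = X𝔖_h (1 + 1_{φ(2^r) ∣ h} (−1)^{h/φ(2^r)} ∏_{p ∣ q', p ∤ h} (−1)/(p − 2))`
`+ O_{C,ε}((h/φ(h)) X (exp(−C√(V log η)) + exp(−C (log X)^{3/5−ε}) + V (log η)^6 / η))`",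
where `𝔖_h = 1_{2 ∣ h} · 2∏_{p>2}(1 − 1/(p−1)²) ∏_{p ∣ h, p > 2}(1 + 1/(p − 2))`
(`Literature.goldbachSingularSeries h`). Here `h = O(X)` is rendered as `h ≤ A·X` with the implied
constant allowed to depend on `A` as well; `r = padicValNat 2 q`, `q' = q / 2^r`. At `h = q`
(even `q`) the correction factor equals `2`: "one would expect that
`∑_{n ≤ X} Λ(n)Λ(n + q) ≈ 2𝔖_q X`. The following general theorem confirms this intuition."
[cite: MatomakiMerikoski2023, Theorem 1.3] -/
def MatomakiMerikoski2023_pairCorrelation : Prop :=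
  ∀ C : ℝ, 1 ≤ C → ∀ ε : ℝ, 0 < ε → ∀ A : ℝ, 0 < A →
    ∃ K : ℝ, 0 < K ∧
      ∀ (q : ℕ) [NeZero q], 2 ≤ q → ∀ χ : DirichletCharacter ℂ q, χ.IsPrimitive → χ.IsQuadratic →
        ∀ η : ℝ, 10 ≤ η → χ.LFunction ((1 - 1 / (η * Real.log q) : ℝ) : ℂ) = 0 →
          ∀ V X : ℝ, 10 ≤ V → X = (q : ℝ) ^ V → ∀ h : ℕ, 1 ≤ h → (h : ℝ) ≤ A * X →
            |(∑ n ∈ Icc 1 ⌊X⌋₊, Λ n * Λ (n + h)) -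
                X * Literature.NumberTheory.Sieve.goldbachSingularSeries h *
                  (1 + if Nat.totient (2 ^ padicValNat 2 q) ∣ h then
                        (-1 : ℝ) ^ (h / Nat.totient (2 ^ padicValNat 2 q)) *
                          ∏ p ∈ (q / 2 ^ padicValNat 2 q).primeFactors.filter (fun p => ¬ p ∣ h),
                            (-1 : ℝ) / ((p : ℝ) - 2)
                      else 0)| ≤
              K * ((h : ℝ) / (Nat.totient h : ℝ)) * X *
                (Real.exp (-C * Real.sqrt (V * Real.log η)) +
                  Real.exp (-C * Real.log X ^ (3 / 5 - ε)) +
                  V * Real.log η ^ (6 : ℕ) / η)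

/-- **Matomäki–Merikoski 2023, Corollary 1.1(i)** (as printed): "Let `h ∈ ℕ`. Let `χ` be a
primitive quadratic character modulo `q ≥ 2` and assume that `L(s, χ)` has a real zero `β₀`
such that `β₀ = 1 − 1/(η log q)` for some `η ≥ 10`. (i) Let `C ≥ 1`. For
`X ∈ [q^{10}, q^{10 log η}]`, we have `∑_{n ≤ X} Λ(n)Λ(n + h) = X𝔖_h + O_{h,C}(X exp(−C√log η))`."
By Siegel's theorem `η ≪_ε q^ε`, so the range is long; this is the fixed-shift Hardy–Littlewood
(Bateman–Horn for `(X, X + h)`) asymptotic PROVED in the presence of an exceptional zero,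
improving Heath-Brown 1983 and Tao–Teräväinen 2021 as reported in §1 ("Such an asymptotic
formula has been previously obtained only for fixed `h` in which case our result quantitatively
improves those of Heath-Brown (1983) and Tao and Teräväinen (2021)").
[cite: MatomakiMerikoski2023, Corollary 1.1(i)] -/
def MatomakiMerikoski2023_fixedShift : Prop :=
  ∀ h : ℕ, 1 ≤ h → ∀ C : ℝ, 1 ≤ C → ∃ K : ℝ, 0 < K ∧
    ∀ (q : ℕ) [NeZero q], 2 ≤ q → ∀ χ : DirichletCharacter ℂ q, χ.IsPrimitive → χ.IsQuadratic →
      ∀ η : ℝ, 10 ≤ η → χ.LFunction ((1 - 1 / (η * Real.log q) : ℝ) : ℂ) = 0 →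
        ∀ X : ℝ, (q : ℝ) ^ (10 : ℝ) ≤ X → X ≤ (q : ℝ) ^ (10 * Real.log η) →
          |(∑ n ∈ Icc 1 ⌊X⌋₊, Λ n * Λ (n + h)) - X * Literature.NumberTheory.Sieve.goldbachSingularSeries h| ≤
            K * X * Real.exp (-C * Real.sqrt (Real.log η))

/-- **Matomäki–Merikoski 2023, Corollary 1.1(ii)** (as printed; `h ∈ ℕ`, `χ` primitive quadratic
mod `q ≥ 2` with a real zero `β₀ = 1 − 1/(η log q)`, `η ≥ 10`, as in part (i)): "Let `ε > 0`. For
`X = q^V` with `V ∈ [10 log η, η^{1−ε}]`, we have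
`∑_{n ≤ X} Λ(n)Λ(n + h) = X𝔖_h + O_h(X log⁶η / (η/V))`." "Note that for
`X ∈ [q^{10 log η}, q^{10 log⁴ η}]` the error term is `O(η^{−1}X log^{10} η)`, where the dependency
on `η` is best that can be hoped for apart from the power of `log η`." Rendered with the implied
constant allowed to depend on `h` and on the `ε` fixed beforehand.
[cite: MatomakiMerikoski2023, Corollary 1.1(ii)] -/
def MatomakiMerikoski2023_fixedShift_ii : Prop :=
  ∀ h : ℕ, 1 ≤ h → ∀ ε : ℝ, 0 < ε → ∃ K : ℝ, 0 < K ∧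
    ∀ (q : ℕ) [NeZero q], 2 ≤ q → ∀ χ : DirichletCharacter ℂ q, χ.IsPrimitive → χ.IsQuadratic →
      ∀ η : ℝ, 10 ≤ η → χ.LFunction ((1 - 1 / (η * Real.log q) : ℝ) : ℂ) = 0 →
        ∀ V X : ℝ, 10 * Real.log η ≤ V → V ≤ η ^ (1 - ε) → X = (q : ℝ) ^ V →
          |(∑ n ∈ Icc 1 ⌊X⌋₊, Λ n * Λ (n + h)) - X * Literature.NumberTheory.Sieve.goldbachSingularSeries h| ≤
            K * X * (Real.log η ^ (6 : ℕ) / (η / V))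


/-- **Matomäki–Merikoski 2023, Corollary 1.2** (as printed): "Let `δ > 0`. There exists
`η = η(δ) ≥ 100` such that the following holds. Let `q ≥ 2` be such that there exists a primitive
quadratic character `χ (mod q)`. Assume that there exists an even `h ∈ [q^{10}, q^{η^{99/100}}]` such
that `q ∣ h` and `δ𝔖_h·h ≤ ∑_{n₁ + n₂ = h} Λ(n₁)Λ(n₂) ≤ (2 − δ)𝔖_h·h`. Then the Dirichlet
`L`-function `L(s, χ)` does not have an exceptional zero `β₀` with `β₀ ≥ 1 − 1/(η log q)`." ("In
fact … we only need the lower bound … if `χ(−1) = −1` and similarly only the upper bound … if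
`χ(−1) = 1`" — not rendered.) The Goldbach sum is the tree's
`Literature.NumberTheory.Sieve.goldbachLambdaCount h` (`= ∑_{m + m' = h} Λ(m)Λ(m')`; the terms with
`m = 0` or `m' = 0` vanish) and `𝔖_h = goldbachSingularSeries h`; "exceptional zero" is rendered as
a real zero `β ∈ [1 − 1/(η log q), 1)`. A PER-MODULUS reduction: ONE Goldbach count of the right
order at one admissible shift `h ≡ 0 (mod q)` excludes Siegel zeros of quality `η(δ)` for `χ mod q`
(it improves Friedlander–Goldston–Iwaniec–Suriajaya, who need several `h ≡ 0 (mod q)`).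
NAMED FACT, not proved here. [cite: MatomakiMerikoski2023, Corollary 1.2] -/
def MatomakiMerikoski2023_corollary12 : Prop :=
  ∀ δ : ℝ, 0 < δ → ∃ η : ℝ, 100 ≤ η ∧
    ∀ (q : ℕ) [NeZero q], 2 ≤ q → ∀ χ : DirichletCharacter ℂ q, χ.IsPrimitive → χ.IsQuadratic →
      (∃ h : ℕ, Even h ∧ (q : ℝ) ^ (10 : ℕ) ≤ (h : ℝ) ∧ (h : ℝ) ≤ (q : ℝ) ^ (η ^ ((99 : ℝ) / 100)) ∧
          q ∣ h ∧
          δ * (Literature.NumberTheory.Sieve.goldbachSingularSeries h * h) ≤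
              Literature.NumberTheory.Sieve.goldbachLambdaCount h ∧
            Literature.NumberTheory.Sieve.goldbachLambdaCount h ≤
              (2 - δ) * (Literature.NumberTheory.Sieve.goldbachSingularSeries h * h)) →
        ∀ β : ℝ, 1 - 1 / (η * Real.log q) ≤ β → β < 1 → χ.LFunction (β : ℂ) ≠ 0

/-- `11 ≤ η^{99/100}` for `η ≥ 100` (`100^{99/100} ≥ 100^{3/4} ≥ 11` as `11⁴ ≤ 100³`). [folklore] -/
private theorem eleven_le_rpow {η : ℝ} (hη : 100 ≤ η) : (11 : ℝ) ≤ η ^ ((99 : ℝ) / 100) := by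
  have h100 : (11 : ℝ) ≤ (100 : ℝ) ^ ((3 : ℝ) / 4) := by
    have h4 : ((100 : ℝ) ^ ((3 : ℝ) / 4)) ^ (4 : ℕ) = (100 : ℝ) ^ (3 : ℕ) := by
      rw [← Real.rpow_natCast, ← Real.rpow_mul (by norm_num : (0 : ℝ) ≤ 100)]
      norm_num
    have hpos : (0 : ℝ) ≤ (100 : ℝ) ^ ((3 : ℝ) / 4) := Real.rpow_nonneg (by norm_num) _
    by_contra hlt
    push Not at hlt
    have : ((100 : ℝ) ^ ((3 : ℝ) / 4)) ^ (4 : ℕ) < (11 : ℝ) ^ (4 : ℕ) :=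
      pow_lt_pow_left₀ hlt hpos (by norm_num)
    rw [h4] at this
    norm_num at this
  calc (11 : ℝ) ≤ (100 : ℝ) ^ ((3 : ℝ) / 4) := h100
    _ ≤ (100 : ℝ) ^ ((99 : ℝ) / 100) :=
        Real.rpow_le_rpow_of_exponent_le (by norm_num) (by norm_num)
    _ ≤ η ^ ((99 : ℝ) / 100) := Real.rpow_le_rpow (by norm_num) hη (by norm_num)

/-- **PROVED reading: the Weak Hardy–Littlewood Goldbach Conjecture feeds Corollary 1.2 at every
large modulus.** Modulo the named fact: if `WeakHLGoldbachConj δ` holds (the two-sided bound for ALL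
large even `n`), then with `η = η(δ) ≥ 100` of Corollary 1.2, for every large `q` and every primitive
quadratic `χ mod q`, `L(β, χ) ≠ 0` for all real `β ∈ [1 − 1/(η log q), 1)` — take the admissible shift
`h = 2q^{10}` (even, `q ∣ h`, `q^{10} ≤ h ≤ q^{11} ≤ q^{η^{99/100}}` since `η^{99/100} ≥ 11`).
[cite: MatomakiMerikoski2023, Corollary 1.2] [cite: GoldstonSuriajaya2021, §1 (5)] -/
theorem MatomakiMerikoski2023.lFunction_ne_zero_of_weakHLGoldbachConj
    (h12 : MatomakiMerikoski2023_corollary12) {δ : ℝ} (hδ : 0 < δ) (hG : WeakHLGoldbachConj δ) :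
    ∃ η : ℝ, 100 ≤ η ∧ ∃ q₀ : ℕ, ∀ (q : ℕ) [NeZero q], q₀ ≤ q → ∀ χ : DirichletCharacter ℂ q,
      χ.IsPrimitive → χ.IsQuadratic →
        ∀ β : ℝ, 1 - 1 / (η * Real.log q) ≤ β → β < 1 → χ.LFunction (β : ℂ) ≠ 0 := by
  obtain ⟨η, hη, H⟩ := h12 δ hδ
  obtain ⟨n₀, hn₀⟩ := hG
  refine ⟨η, hη, max n₀ 2, fun q _ hq χ hprim hquad β hβ hβ1 ↦ ?_⟩
  have hq2 : 2 ≤ q := le_trans (le_max_right _ _) hq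
  have hqn₀ : n₀ ≤ q := le_trans (le_max_left _ _) hq
  refine H q hq2 χ hprim hquad ⟨2 * q ^ 10, ?_, ?_, ?_, ?_, ?_⟩ β hβ hβ1
  · exact even_two_mul _
  · push_cast
    have : (0 : ℝ) ≤ (q : ℝ) ^ 10 := by positivity
    linarith
  · -- 2 q^10 ≤ q^11 ≤ q^{η^{99/100}}
    have hq1 : (1 : ℝ) ≤ q := by exact_mod_cast le_trans (by norm_num) hq2
    have hq2' : (2 : ℝ) ≤ q := by exact_mod_cast hq2
    have h11 : (2 : ℝ) * (q : ℝ) ^ 10 ≤ (q : ℝ) ^ (11 : ℕ) := by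
      rw [pow_succ]
      have : (0 : ℝ) ≤ (q : ℝ) ^ 10 := by positivity
      nlinarith
    have hexp : (q : ℝ) ^ (11 : ℕ) ≤ (q : ℝ) ^ (η ^ ((99 : ℝ) / 100)) := by
      rw [← Real.rpow_natCast]
      exact Real.rpow_le_rpow_of_exponent_le hq1 (by exact_mod_cast eleven_le_rpow hη)
    push_cast
    exact h11.trans hexp
  · exact Dvd.dvd.mul_left (dvd_pow_self q (by norm_num)) 2
  · have hq1 : 1 ≤ q := le_trans (by norm_num) hq2
    have hle : n₀ ≤ 2 * q ^ 10 := by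
      calc n₀ ≤ q := hqn₀
        _ ≤ q ^ 10 := Nat.le_self_pow (by norm_num) q
        _ ≤ 2 * q ^ 10 := by omega
    exact hn₀ (2 * q ^ 10) hle (even_two_mul _)

end Literature.Barriers.Parity
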